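import Mathlib
import HarnessLib
import Literature.Probability.Percolation.Percolation
import Literature.Probability.Percolation.PercolationProofs
import Literature.Probability.Percolation.PercolationEvents
import Literature.Probability.Percolation.FiniteEnergy
import Literature.Probability.Percolation.StoppingSetDecoupling
import Literature.Probability.Percolation.BondStoppingSetDecoupling
import Literature.Probability.Percolation.InequalitiesProofs
import Summits.CriticalPhenomena.PercolationContinuityZ3.Theorems.PercTreeValueTetrahedronLogConvexityCertDefs

/-!
# Strong Markov property of the truncated two-seed exploration (stub `stub_strongMarkov`)

Crux `TetrahedronLogConvexity` (stmt-CriticalPhenomena-7801), line `Sketch` (certificate form).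
The objects are those of `PercTreeValueTetrahedronLogConvexityCertDefs.lean`: the examined edges
`explored r R ω` of the truncated two-seed exploration (a finite subset of the window
`edgeWindow r R`), the merged event `AR r R = {NR < R}`, the hybrid configuration
`hyb r R (ω, ω') = (ω ∩ explored ω) ∪ (ω' ∖ explored ω)` and the two-continuation capture
functional `Qbc`.

Main result `stub_strongMarkov` (Gladkov, arXiv:2408.08457, Lemma 3.1, in our concrete setting;
"strong Markov property for stopping sets"): ASSUMING the stopping property of `explored r R`
and that `NR r R` is decided by the examined edges,
* (i) jointly with `A_R`, the hybrid `hyb (ω, ω')` under `P ⊗ P` has the law of `ω` under `P`: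
  `(P ⊗ P){ω ∈ A_R, hyb(ω, ω') ∈ E} = P(A_R ∩ E)` for every measurable `E`;
* (ii) two INDEPENDENT continuations capture `b_r` and `c_r` less often than one:
  `Qbc ≤ P(A_R, 0 ↔ b_r, 0 ↔ c_r)` (Harris–FKG on the continuation).

Proof (the bookkeeping of `bond_real_mem_dataEvent_eq`, `BondStoppingSetDecoupling.lean`):
partition the configuration space by the explored DATA `d = (F, η)` (`F` = examined edges,
`η` = the open ones; pieces `dataPiece (explored r R) F η`, indexed by the finite set of pairs
`η ⊆ F ⊆ edgeWindow`). On the piece of `d`: the hybrid is the continuation map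
`ζ ↦ η ∪ (ζ ∖ F)` of the second coordinate alone (`markov_hyb_eq`), a configuration is its own
continuation (`markov_self_eq`), `A_R` is decided (`markov_determinedBy_pieceA`: the piece meets
`A_R` in an event determined by the edges of `F`), while continuation events are determined by
the edges OFF `F` (`markov_determinedBy_cont`). Hence both sides of (i) equal
`Σ_d P(piece_d ∩ A_R) · P(cont_d ∈ E)` — the left side by Fubini on measurable rectangles
(`measureReal_prod_prod`), the right side by the independence of disjoint edge sets
(`bondPercolation_real_inter_of_disjoint`, which allows the infinite set `Fᶜ`). For (ii) the
triple product gives `Σ_d P(piece_d ∩ A_R) · P(cont_d ∈ B) · P(cont_d ∈ C)`; the continuation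
events of the increasing events `B = {0 ↔ b_r}`, `C = {0 ↔ c_r}` are increasing, and Harris
(`harris_fkg_holds`) bounds each term by the corresponding term of (i) for `E = B ∩ C`.
-/

noncomputable section

open MeasureTheory
open Literature.Probability.Percolation Literature.Probability.LatticeModels

namespace Summit.CriticalPhenomena.PercolationContinuityZ3.Theorems.TetrahedronLogConvexity.Cert

variable {r R : ℕ}

/-! ### The pieces of the data partition and the continuation map -/

/-- On the piece with data `(F, η)` (`η ⊆ F`) the hybrid is the continuation map
`ω' ↦ η ∪ (ω' ∖ F)` applied to the second coordinate. [folklore] -/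
theorem markov_hyb_eq {F η : Finset (Sym2 (Site 3))} (hη : η ⊆ F) {ω : BondConfig (Site 3)}
    (hω : ω ∈ dataPiece (explored r R) F η) (ω' : BondConfig (Site 3)) :
    hyb r R (ω, ω') = (↑η : Set (Sym2 (Site 3))) ∪ (ω' \ ↑F) := by
  obtain ⟨hF, hFη⟩ := hω
  ext e
  rw [mem_hyb_iff]
  simp only [hF, Set.mem_union, Set.mem_sdiff, Finset.mem_coe]
  constructor
  · rintro (⟨heω, heF⟩ | ⟨heω', heF⟩)
    · exact Or.inl ((hFη e heF).1 heω)
    · exact Or.inr ⟨heω', heF⟩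
  · rintro (heη | ⟨heω', heF⟩)
    · exact Or.inl ⟨(hFη e (hη heη)).2 heη, hη heη⟩
    · exact Or.inr ⟨heω', heF⟩

/-- A configuration in the piece with data `(F, η)` (`η ⊆ F`) is its own continuation:
`η ∪ (ω ∖ F) = ω`. [folklore] -/
theorem markov_self_eq {F η : Finset (Sym2 (Site 3))} (hη : η ⊆ F) {ω : BondConfig (Site 3)}
    (hω : ω ∈ dataPiece (explored r R) F η) :
    (↑η : Set (Sym2 (Site 3))) ∪ (ω \ ↑F) = ω := by
  obtain ⟨-, hFη⟩ := hω
  ext e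
  simp only [Set.mem_union, Set.mem_sdiff, Finset.mem_coe]
  constructor
  · rintro (heη | ⟨heω, -⟩)
    · exact (hFη e (hη heη)).2 heη
    · exact heω
  · intro heω
    by_cases heF : e ∈ F
    · exact Or.inl ((hFη e heF).1 heω)
    · exact Or.inr ⟨heω, heF⟩

open Classical in
/-- Every configuration lies in the piece of its own data `(explored ω, open examined edges)`,
an admissible index (`η ⊆ F ⊆ edgeWindow`). [folklore] -/
theorem markov_exists_piece (r R : ℕ) (ω : BondConfig (Site 3)) :
    ∃ d ∈ ((edgeWindow r R).powerset ×ˢ (edgeWindow r R).powerset).filter (fun d => d.2 ⊆ d.1),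
      ω ∈ dataPiece (explored r R) d.1 d.2 := by
  refine ⟨(explored r R ω, (explored r R ω).filter (· ∈ ω)), ?_, mem_dataPiece_self _ _⟩
  rw [Finset.mem_filter, Finset.mem_product, Finset.mem_powerset, Finset.mem_powerset]
  exact ⟨⟨explored_subset_edgeWindow r R ω,
    (Finset.filter_subset _ _).trans (explored_subset_edgeWindow r R ω)⟩, Finset.filter_subset _ _⟩

/-- **`A_R` is decided by the data.** Under the stopping property and the determination of `NR`
by the examined edges, the trace of `A_R` on the piece with data `(F, η)` is an event determined
by the edges of `F`. [folklore] -/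
theorem markov_determinedBy_pieceA (hstop : IsStoppingSet (explored r R))
    (hNR : ∀ ω ω' : BondConfig (Site 3), (∀ e ∈ explored r R ω, e ∈ ω ↔ e ∈ ω') →
      NR r R ω' = NR r R ω)
    (F η : Finset (Sym2 (Site 3))) :
    DeterminedBy (dataPiece (explored r R) F η ∩ AR r R) (↑F : Set (Sym2 (Site 3))) := by
  have hP := determinedBy_dataPiece hstop F η
  rw [determinedBy_iff] at hP ⊢
  have key : ∀ ω ω' : BondConfig (Site 3), ω ∩ ↑F = ω' ∩ ↑F →
      ω ∈ dataPiece (explored r R) F η ∩ AR r R → ω' ∈ dataPiece (explored r R) F η ∩ AR r R := by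
    rintro ω ω' h ⟨hω, hA⟩
    have hω' : ω' ∈ dataPiece (explored r R) F η := (hP ω ω' h).1 hω
    refine ⟨hω', ?_⟩
    rw [mem_AR_iff] at hA ⊢
    have hag : ∀ e ∈ explored r R ω, e ∈ ω ↔ e ∈ ω' := by
      intro e he
      rw [hω.1] at he
      exact (hω.2 e he).trans (hω'.2 e he).symm
    rw [hNR ω ω' hag]
    exact hA
  exact fun ω ω' h => ⟨key ω ω' h, key ω' ω h.symm⟩

open Classical in
/-- Distinct admissible data give disjoint pieces (and disjoint traces of `A_R`). [folklore] -/
theorem markov_pairwiseDisjoint_pieceA (r R : ℕ) :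
    (↑(((edgeWindow r R).powerset ×ˢ (edgeWindow r R).powerset).filter (fun d => d.2 ⊆ d.1)) :
      Set (Finset (Sym2 (Site 3)) × Finset (Sym2 (Site 3)))).PairwiseDisjoint
      fun d => dataPiece (explored r R) d.1 d.2 ∩ AR r R := by
  intro d hd d' hd' hne
  have h1 : d.2 ⊆ d.1 := (Finset.mem_filter.1 (Finset.mem_coe.1 hd)).2
  have h2 : d'.2 ⊆ d'.1 := (Finset.mem_filter.1 (Finset.mem_coe.1 hd')).2
  exact (disjoint_dataPiece h1 h2 (by rwa [Prod.mk.eta, Prod.mk.eta])).mono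
    Set.inter_subset_left Set.inter_subset_left

/-- An event of the continuation `ζ ↦ η ∪ (ζ ∖ F)` is determined by the edges off `F`. [folklore] -/
theorem markov_determinedBy_cont (F η : Finset (Sym2 (Site 3))) (E : Set (BondConfig (Site 3))) :
    DeterminedBy ((fun ζ : BondConfig (Site 3) =>
      ((↑η : Set (Sym2 (Site 3))) ∪ (ζ \ ↑F) : BondConfig (Site 3))) ⁻¹' E)
      (↑F : Set (Sym2 (Site 3)))ᶜ := by
  rw [determinedBy_iff]
  intro ω ω' h
  simp only [Set.mem_preimage]
  rw [Set.sdiff_eq, Set.sdiff_eq, h]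

/-- The continuation map `ζ ↦ η ∪ (ζ ∖ F)` is measurable (each coordinate is a constant or a
coordinate). [folklore] -/
theorem markov_measurable_cont (F η : Finset (Sym2 (Site 3))) :
    Measurable (fun ζ : BondConfig (Site 3) =>
      ((↑η : Set (Sym2 (Site 3))) ∪ (ζ \ ↑F) : BondConfig (Site 3))) := by
  refine measurable_set_iff.2 fun e => ?_
  have h : (fun ζ : BondConfig (Site 3) => e ∈ ((↑η : Set (Sym2 (Site 3))) ∪ (ζ \ ↑F))) =
      fun ζ => e ∈ η ∨ (e ∈ ζ ∧ e ∉ F) := by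
    funext ζ
    simp
  rw [h]
  exact measurable_const.or ((measurable_set_mem e).and measurable_const)

/-- The continuation event of an increasing event is increasing (the continuation map is
monotone and `E` is an upper set). [folklore] -/
theorem markov_isUpperSet_cont (F η : Finset (Sym2 (Site 3))) {E : Set (BondConfig (Site 3))}
    (hE : IsUpperSet E) :
    IsUpperSet ((fun ζ : BondConfig (Site 3) =>
      ((↑η : Set (Sym2 (Site 3))) ∪ (ζ \ ↑F) : BondConfig (Site 3))) ⁻¹' E) :=
  hE.preimage fun _ _ h => Set.union_subset_union_right _ (Set.sdiff_subset_sdiff_left h)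

/-! ### Part (i): the hybrid has the law of `ω`, jointly with `A_R` -/

open Classical in
/-- The event `{ω ∈ A_R, hyb(ω, ω') ∈ E}` is the finite disjoint union over the data `d` of the
rectangles `(piece_d ∩ A_R) × {cont_d ∈ E}`. [folklore] -/
theorem markov_setOf_hyb_eq (r R : ℕ) (E : Set (BondConfig (Site 3))) :
    {x : BondConfig (Site 3) × BondConfig (Site 3) | x.1 ∈ AR r R ∧ hyb r R x ∈ E} =
      ⋃ d ∈ ((edgeWindow r R).powerset ×ˢ (edgeWindow r R).powerset).filter (fun d => d.2 ⊆ d.1),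
        (dataPiece (explored r R) d.1 d.2 ∩ AR r R) ×ˢ
          ((fun ζ : BondConfig (Site 3) =>
            ((↑d.2 : Set (Sym2 (Site 3))) ∪ (ζ \ ↑d.1) : BondConfig (Site 3))) ⁻¹' E) := by
  ext x
  simp only [Set.mem_setOf_eq, Set.mem_iUnion, Set.mem_prod, Set.mem_inter_iff, Set.mem_preimage,
    exists_prop]
  constructor
  · rintro ⟨hA, hE⟩
    obtain ⟨d, hd, hω⟩ := markov_exists_piece r R x.1
    refine ⟨d, hd, ⟨hω, hA⟩, ?_⟩
    have h := markov_hyb_eq (Finset.mem_filter.1 hd).2 hω x.2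
    rw [Prod.mk.eta] at h
    rw [← h]
    exact hE
  · rintro ⟨d, hd, ⟨hω, hA⟩, hE⟩
    refine ⟨hA, ?_⟩
    have h := markov_hyb_eq (Finset.mem_filter.1 hd).2 hω x.2
    rw [Prod.mk.eta] at h
    rw [h]
    exact hE

open Classical in
/-- **Fubini side of (i)**: `(P ⊗ P){ω ∈ A_R, hyb ∈ E} = Σ_d P(piece_d ∩ A_R) · P(cont_d ∈ E)`. [folklore] -/
theorem markov_prod_real_eq_sum (hstop : IsStoppingSet (explored r R))
    (hNR : ∀ ω ω' : BondConfig (Site 3), (∀ e ∈ explored r R ω, e ∈ ω ↔ e ∈ ω') →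
      NR r R ω' = NR r R ω)
    {E : Set (BondConfig (Site 3))} (hE : MeasurableSet E) :
    (Pc.prod Pc).real {x : BondConfig (Site 3) × BondConfig (Site 3) | x.1 ∈ AR r R ∧ hyb r R x ∈ E} =
      ∑ d ∈ ((edgeWindow r R).powerset ×ˢ (edgeWindow r R).powerset).filter (fun d => d.2 ⊆ d.1),
        Pc.real (dataPiece (explored r R) d.1 d.2 ∩ AR r R) *
          Pc.real ((fun ζ : BondConfig (Site 3) =>
            ((↑d.2 : Set (Sym2 (Site 3))) ∪ (ζ \ ↑d.1) : BondConfig (Site 3))) ⁻¹' E) := by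
  rw [markov_setOf_hyb_eq r R E, measureReal_biUnion_finset ?_ ?_]
  · exact Finset.sum_congr rfl fun d _ => measureReal_prod_prod _ _
  · exact fun d hd d' hd' hne =>
      Set.Disjoint.set_prod_left (markov_pairwiseDisjoint_pieceA r R hd hd' hne) _ _
  · exact fun d _ => (markov_determinedBy_pieceA hstop hNR d.1 d.2).measurableSet_of_finset.prod
      (hE.preimage (markov_measurable_cont d.1 d.2))

open Classical in
/-- The event `A_R ∩ E` is the finite disjoint union over the data `d` of the events
`(piece_d ∩ A_R) ∩ {cont_d ∈ E}` (a configuration is its own continuation). [folklore] -/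
theorem markov_inter_eq (r R : ℕ) (E : Set (BondConfig (Site 3))) :
    AR r R ∩ E =
      ⋃ d ∈ ((edgeWindow r R).powerset ×ˢ (edgeWindow r R).powerset).filter (fun d => d.2 ⊆ d.1),
        (dataPiece (explored r R) d.1 d.2 ∩ AR r R) ∩
          ((fun ζ : BondConfig (Site 3) =>
            ((↑d.2 : Set (Sym2 (Site 3))) ∪ (ζ \ ↑d.1) : BondConfig (Site 3))) ⁻¹' E) := by
  ext ω
  simp only [Set.mem_iUnion, Set.mem_inter_iff, Set.mem_preimage, exists_prop]
  constructor
  · rintro ⟨hA, hE⟩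
    obtain ⟨d, hd, hω⟩ := markov_exists_piece r R ω
    refine ⟨d, hd, ⟨hω, hA⟩, ?_⟩
    rw [markov_self_eq (Finset.mem_filter.1 hd).2 hω]
    exact hE
  · rintro ⟨d, hd, ⟨hω, hA⟩, hE⟩
    rw [markov_self_eq (Finset.mem_filter.1 hd).2 hω] at hE
    exact ⟨hA, hE⟩

open Classical in
/-- **Independence side of (i)**: `P(A_R ∩ E) = Σ_d P(piece_d ∩ A_R) · P(cont_d ∈ E)`, by the
independence of the edges of `F` and the edges off `F`. [folklore] -/
theorem markov_real_inter_eq_sum (hstop : IsStoppingSet (explored r R))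
    (hNR : ∀ ω ω' : BondConfig (Site 3), (∀ e ∈ explored r R ω, e ∈ ω ↔ e ∈ ω') →
      NR r R ω' = NR r R ω)
    {E : Set (BondConfig (Site 3))} (hE : MeasurableSet E) :
    Pc.real (AR r R ∩ E) =
      ∑ d ∈ ((edgeWindow r R).powerset ×ˢ (edgeWindow r R).powerset).filter (fun d => d.2 ⊆ d.1),
        Pc.real (dataPiece (explored r R) d.1 d.2 ∩ AR r R) *
          Pc.real ((fun ζ : BondConfig (Site 3) =>
            ((↑d.2 : Set (Sym2 (Site 3))) ∪ (ζ \ ↑d.1) : BondConfig (Site 3))) ⁻¹' E) := by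
  rw [markov_inter_eq r R E, measureReal_biUnion_finset ?_ ?_]
  · refine Finset.sum_congr rfl fun d _ => ?_
    exact bondPercolation_real_inter_of_disjoint (zdGraph 3) (criticalProbI 3) disjoint_compl_right
      (markov_determinedBy_pieceA hstop hNR d.1 d.2) (markov_determinedBy_cont d.1 d.2 E)
      (markov_determinedBy_pieceA hstop hNR d.1 d.2).measurableSet_of_finset
      (hE.preimage (markov_measurable_cont d.1 d.2))
  · exact fun d hd d' hd' hne => (markov_pairwiseDisjoint_pieceA r R hd hd' hne).mono
      Set.inter_subset_left Set.inter_subset_left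
  · exact fun d _ => (markov_determinedBy_pieceA hstop hNR d.1 d.2).measurableSet_of_finset.inter
      (hE.preimage (markov_measurable_cont d.1 d.2))

/-! ### Part (ii): two independent continuations (Harris on the continuation) -/

open Classical in
/-- The event `{ω ∈ A_R, hyb(ω, ω') ∈ B, hyb(ω, ω'') ∈ C}` is the finite disjoint union over the
data `d` of the rectangles `(piece_d ∩ A_R) × ({cont_d ∈ B} × {cont_d ∈ C})`. [folklore] -/
theorem markov_setOf_hyb₂_eq (r R : ℕ) (B C : Set (BondConfig (Site 3))) :
    {x : BondConfig (Site 3) × (BondConfig (Site 3) × BondConfig (Site 3)) |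
        x.1 ∈ AR r R ∧ hyb r R (x.1, x.2.1) ∈ B ∧ hyb r R (x.1, x.2.2) ∈ C} =
      ⋃ d ∈ ((edgeWindow r R).powerset ×ˢ (edgeWindow r R).powerset).filter (fun d => d.2 ⊆ d.1),
        (dataPiece (explored r R) d.1 d.2 ∩ AR r R) ×ˢ
          (((fun ζ : BondConfig (Site 3) =>
              ((↑d.2 : Set (Sym2 (Site 3))) ∪ (ζ \ ↑d.1) : BondConfig (Site 3))) ⁻¹' B) ×ˢ
            ((fun ζ : BondConfig (Site 3) =>
              ((↑d.2 : Set (Sym2 (Site 3))) ∪ (ζ \ ↑d.1) : BondConfig (Site 3))) ⁻¹' C)) := by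
  ext x
  simp only [Set.mem_setOf_eq, Set.mem_iUnion, Set.mem_prod, Set.mem_inter_iff, Set.mem_preimage,
    exists_prop]
  constructor
  · rintro ⟨hA, hB, hC⟩
    obtain ⟨d, hd, hω⟩ := markov_exists_piece r R x.1
    refine ⟨d, hd, ⟨hω, hA⟩, ?_, ?_⟩
    · rw [← markov_hyb_eq (Finset.mem_filter.1 hd).2 hω x.2.1]
      exact hB
    · rw [← markov_hyb_eq (Finset.mem_filter.1 hd).2 hω x.2.2]
      exact hC
  · rintro ⟨d, hd, ⟨hω, hA⟩, hB, hC⟩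
    refine ⟨hA, ?_, ?_⟩
    · rw [markov_hyb_eq (Finset.mem_filter.1 hd).2 hω x.2.1]
      exact hB
    · rw [markov_hyb_eq (Finset.mem_filter.1 hd).2 hω x.2.2]
      exact hC

open Classical in
/-- **Fubini for two continuations**:
`(P ⊗ P ⊗ P){ω ∈ A_R, hyb' ∈ B, hyb'' ∈ C} = Σ_d P(piece_d ∩ A_R) · (P(cont_d ∈ B) · P(cont_d ∈ C))`. [folklore] -/
theorem markov_prod₃_real_eq_sum (hstop : IsStoppingSet (explored r R))
    (hNR : ∀ ω ω' : BondConfig (Site 3), (∀ e ∈ explored r R ω, e ∈ ω ↔ e ∈ ω') →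
      NR r R ω' = NR r R ω)
    {B C : Set (BondConfig (Site 3))} (hB : MeasurableSet B) (hC : MeasurableSet C) :
    (Pc.prod (Pc.prod Pc)).real {x : BondConfig (Site 3) × (BondConfig (Site 3) × BondConfig (Site 3)) |
        x.1 ∈ AR r R ∧ hyb r R (x.1, x.2.1) ∈ B ∧ hyb r R (x.1, x.2.2) ∈ C} =
      ∑ d ∈ ((edgeWindow r R).powerset ×ˢ (edgeWindow r R).powerset).filter (fun d => d.2 ⊆ d.1),
        Pc.real (dataPiece (explored r R) d.1 d.2 ∩ AR r R) *
          (Pc.real ((fun ζ : BondConfig (Site 3) =>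
              ((↑d.2 : Set (Sym2 (Site 3))) ∪ (ζ \ ↑d.1) : BondConfig (Site 3))) ⁻¹' B) *
            Pc.real ((fun ζ : BondConfig (Site 3) =>
              ((↑d.2 : Set (Sym2 (Site 3))) ∪ (ζ \ ↑d.1) : BondConfig (Site 3))) ⁻¹' C)) := by
  rw [markov_setOf_hyb₂_eq r R B C, measureReal_biUnion_finset ?_ ?_]
  · refine Finset.sum_congr rfl fun d _ => ?_
    rw [measureReal_prod_prod, measureReal_prod_prod]
  · exact fun d hd d' hd' hne =>
      Set.Disjoint.set_prod_left (markov_pairwiseDisjoint_pieceA r R hd hd' hne) _ _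
  · exact fun d _ => (markov_determinedBy_pieceA hstop hNR d.1 d.2).measurableSet_of_finset.prod
      ((hB.preimage (markov_measurable_cont d.1 d.2)).prod
        (hC.preimage (markov_measurable_cont d.1 d.2)))

/-! ### The stub -/

/-- **Strong Markov property of the truncated two-seed exploration** (stub `stub_strongMarkov`
of the certificate line; Gladkov's Lemma 3.1, arXiv:2408.08457, in the concrete setting of the
mirror certificate). Assume the examined edges `explored r R` form a stopping set which decides
the merge layer `NR r R`. Then (i) jointly with `A_R = {NR < R}`, the hybrid configuration
"certificate of `ω` continued by an independent `ω'`" has under `P ⊗ P` the law of `ω` under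
`P = P_{p_c}(ℤ³)`: `(P ⊗ P){ω ∈ A_R, hyb(ω,ω') ∈ E} = P(A_R ∩ E)` for measurable `E`; and
(ii) capturing `b_r` and `c_r` with two independent continuations is at most as likely as with
one: `Qbc ≤ P(A_R ∩ {0 ↔ b_r} ∩ {0 ↔ c_r})` (Harris–FKG applied to the increasing continuation
events, data by data). [folklore] -/
theorem stub_strongMarkov : ∀ r R : ℕ,
    (IsStoppingSet (explored r R) ∧
      ∀ ω ω' : BondConfig (Site 3), (∀ e ∈ explored r R ω, e ∈ ω ↔ e ∈ ω') → NR r R ω' = NR r R ω) →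
    (∀ E : Set (BondConfig (Site 3)), MeasurableSet E →
      (Pc.prod Pc).real {x | x.1 ∈ AR r R ∧ hyb r R x ∈ E} = Pc.real (AR r R ∩ E)) ∧
    Qbc r R ≤ Pc.real (AR r R ∩ openConn 0 (vB r) ∩ openConn 0 (vC r)) := by
  intro r R h
  obtain ⟨hstop, hNR⟩ := h
  refine ⟨fun E hE => ?_, ?_⟩
  · rw [markov_prod_real_eq_sum hstop hNR hE, markov_real_inter_eq_sum hstop hNR hE]
  · have hB : MeasurableSet (openConn 0 (vB r) : Set (BondConfig (Site 3))) :=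
      measurableSet_openConn_holds 0 (vB r)
    have hC : MeasurableSet (openConn 0 (vC r) : Set (BondConfig (Site 3))) :=
      measurableSet_openConn_holds 0 (vC r)
    unfold Qbc
    rw [markov_prod₃_real_eq_sum hstop hNR hB hC, Set.inter_assoc,
      markov_real_inter_eq_sum hstop hNR (hB.inter hC)]
    refine Finset.sum_le_sum fun d _ => mul_le_mul_of_nonneg_left ?_ measureReal_nonneg
    rw [Set.preimage_inter]
    exact harris_fkg_holds (zdGraph 3) (criticalProbI 3)
      (markov_isUpperSet_cont d.1 d.2 (isUpperSet_openConn 0 (vB r)))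
      (markov_isUpperSet_cont d.1 d.2 (isUpperSet_openConn 0 (vC r)))
      (hB.preimage (markov_measurable_cont d.1 d.2)) (hC.preimage (markov_measurable_cont d.1 d.2))

end Summit.CriticalPhenomena.PercolationContinuityZ3.Theorems.TetrahedronLogConvexity.Cert

end
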